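import Literature.AlgebraicGeometry.Frobenioids.CharacteristicSplitting
import Literature.AlgebraicGeometry.Frobenioids.IsotropicFrobenioid
import Literature.AlgebraicGeometry.Frobenioids.IsotropicFrobeniusTrivial
import HarnessLib

/-!
# Frobenioids I, Proposition 2.5 (ii): `C^istr` is of base-trivial type and Frobenius-trivial — proof

Mochizuki, *The geometry of Frobenioids I: the general theory*, Kyushu J. Math. **62** (2008)
293–400, §2, Proposition 2.5 (ii) and its proof, kurims text pp. 48–49
[cite: MochizukiFrdI2008, Prop. 2.5(ii) p.48].  PROOF-ONLY companion of
`CharacteristicSplitting.lean` (no new definitions): discharges the named statement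
`IstrBaseTrivialFrobeniusTrivial F`.

Proof (p. 49): "Since `C` is of metrically trivial type, it follows from the existence of
[necessarily co-angular — cf. Proposition 1.4, (i)] pre-steps relating base-isomorphic objects of
`C^istr` [cf. Definition 1.3, (i), (b)], that the isomorphism class of an object of `C^istr` is
completely determined by the isomorphism class of `D` to which it projects.  In particular, it
follows from the existence of Frobenius-trivial objects [cf. Definition 1.3, (i), (a)] that every
object of `C^istr` is Frobenius-trivial."  Def. 1.3 (i)(a), (b) are applied to the Frobenioid
`C^istr` (Prop. 1.9 (v), `isFrobenioid_istr`); only metric triviality is used (the hypotheses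
"Frobenius-normalized" and "`Aut`-ample" of Prop. 2.5 are not needed for (ii)).  Arrows out of an
isotropic object are co-angular by Prop. 1.4 (i) and Def. 1.3 (vii)(b).
-/

namespace Literature.AlgebraicGeometry.Frobenioids

open CategoryTheory Opposite

universe w v v' u u'

namespace PreFrobenioid

variable {D : Type u} [Category.{v} D] {Φ : Dᵒᵖ ⥤ CommMonCat.{w}}
  {C : Type u'} [Category.{v'} C] {F : C ⥤ ElemFrobenioid Φ}

/-- **Prop. 2.5 (ii)**, first sentence, for a Frobenioid of metrically trivial type: `C^istr` is of
base-trivial type (base-isomorphic isotropic objects are joined by co-angular pre-steps out of a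
common isotropic object, Def. 1.3 (i)(b), whose codomains are isomorphic to it by metric triviality).
[cite: MochizukiFrdI2008, Prop. 2.5(ii) p.48] -/
theorem isOfType_isBaseTrivial_istr (hF : IsFrobenioid F) (hmt : IsOfType (IsMetricallyTrivial F)) :
    IsOfType (IsBaseTrivial ((isotropicObjects F).ι ⋙ F)) := by
  intro A B hAB
  obtain ⟨j⟩ := hAB
  -- Def. 1.3 (i)(b) in the Frobenioid `C^istr` (Prop. 1.9 (v))
  obtain ⟨E, γ, γ', hγ, hγ', -⟩ := (isFrobenioid_istr hF).i_b A B j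
  have hco : ∀ {Y : C} (g : E.obj ⟶ Y), IsCoAngular F g := fun g =>
    isCoAngular_of_isIsotropic_codomains F g fun _ g' => hF.vii_b g' E.property
  obtain ⟨e₁⟩ := hmt E.obj γ.hom (hco γ.hom) ((isPreStep_istr_iff γ).mp hγ)
  obtain ⟨e₂⟩ := hmt E.obj γ'.hom (hco γ'.hom) ((isPreStep_istr_iff γ').mp hγ')
  exact ⟨(isotropicObjects F).isoMk (e₂ ≪≫ e₁.symm)⟩

/-- **Prop. 2.5 (ii)**, second sentence, for a Frobenioid of metrically trivial type: every object of
`C^istr` is Frobenius-trivial (Def. 1.3 (i)(a) for the Frobenioid `C^istr` provides a Frobenius-trivial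
isotropic object over the same base, isomorphic to the given one by base-triviality).
[cite: MochizukiFrdI2008, Prop. 2.5(ii) p.48] -/
theorem isOfType_isFrobeniusTrivial_istr (hF : IsFrobenioid F)
    (hmt : IsOfType (IsMetricallyTrivial F)) :
    IsOfType (IsFrobeniusTrivial ((isotropicObjects F).ι ⋙ F)) := by
  intro A
  have hFi := isFrobenioid_istr hF
  obtain ⟨A', hA', ⟨i⟩⟩ := hFi.i_a (baseObj F A.obj)
  obtain ⟨e⟩ := isOfType_isBaseTrivial_istr hF hmt A A' ⟨i.symm⟩
  exact IsFrobeniusTrivial.of_iso _ hFi e hA'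

/-- **Prop. 2.5 (ii)** as stated (`IstrBaseTrivialFrobeniusTrivial`): for a Frobenioid of
Frobenius-normalized, metrically trivial and `Aut`-ample type, "`C^istr` is of base-trivial type.
Moreover, every object of `C^istr` is Frobenius-trivial." [cite: MochizukiFrdI2008, Prop. 2.5(ii) p.48] -/
theorem istrBaseTrivialFrobeniusTrivial : IstrBaseTrivialFrobeniusTrivial F :=
  fun hF _ hmt _ => ⟨isOfType_isBaseTrivial_istr hF hmt, isOfType_isFrobeniusTrivial_istr hF hmt⟩

/-- `IstrBaseTrivialFrobeniusTrivial` holds for all parameters — `_holds` alias of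
`istrBaseTrivialFrobeniusTrivial` above (appended 2026-08-28, D-0026 bookkeeping: the proof term
is the existing theorem of this file; no statement, definition or attribute is edited; no new
named fact).
[cite: MochizukiFrdI2008, Prop. 2.5(ii) p.48] -/
theorem IstrBaseTrivialFrobeniusTrivial_holds : IstrBaseTrivialFrobeniusTrivial F :=
  istrBaseTrivialFrobeniusTrivial (F := F)

end PreFrobenioid

end Literature.AlgebraicGeometry.Frobenioids
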